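import Mathlib
import HarnessLib
import Literature.MathematicalPhysics.QuantumLattice.GrassmannKernelsPresented
import Summits.HubbardSuperconductivity.HubbardSuperconductivity.Theorems.KLProgrammeKLRegimeTwoVolumeLipJumpDefs
import Summits.HubbardSuperconductivity.HubbardSuperconductivity.Theorems.KLProgrammeKLRegimeTwoVolumeLipGlueTransfer

/-!
# Route `KLProgramme` — crux K3 ENGINE (stmt-HubbardSuperconductivity-20437), stub (e) proof-input «(e)-D-ROWS», F-D6: THE INPUT DIFFERENCE OF BLOCK `k`
# RE-MEASURED — EACH EARLIER BORN DIFFERENCE THROUGH THE TRANSFER DOOR AT THE JUMP MATRIX, AND THE PIN-LEVEL SUM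
# (seat hubbard-kl-k3c4-p1 g23; `--supports` 20437; DROWS-SCOPE-g23 §9.4 F-D6)

`…TwoVolumeLipJumpDefs.klLipInputDiff_eq_base_add_sum` writes the input difference `D_k` of block `k` (`2 ≤ d`) as the two-volume difference of `𝒱₀`
analysed at `F_{dk−1}` plus, for every earlier block `k′ < k`, the jump-transferred born terms `map klJump′ (klLipBorn (bL) k′) − klGlue (map klJump (klLipBorn L k′))`.
Here each summand goes through the canonical transfer door `…TwoVolumeLipGlueTransfer.klGlue_transfer_le` at `T′, T := klJump (bL), klJump L` — the
periodisation is DISCHARGED by `klJump_periodise` and the defect `W′ − klGlue W` IS the born difference `klLipBornDiff … d k′` of block `k′`, so its profiles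
are the (already bounded, `…LipSourceTransfer.sum_pinned_norm_kernel_klLipBornDiff_le_of_parts`) born-difference profiles — and the pin-level sum is assembled.

* `lipRemeasureSummand_le` — the summand of block `k′` at an output pin: `≤ aⁿ(aE + τ·ND) + (2aⁿτN + n·aⁿ(5τN + 2a·N_far))` with `E`, `ND` the born-difference
  profiles of block `k′`, `N`, `N_far` the coarse born profiles of block `k′`, `a`, `τ` the rows / tails of the fine jump matrix.
* `sum_pinned_norm_kernel_klLipInputDiff_le_of_parts` — `Σ_{X i = w} ‖kernel D_k X‖ ≤ B₀ + Σ_{k′<k} B k′`.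

Compositions of landed theorems; rows / profiles / the base bound are hypotheses; nothing asserts the (D) rows, stub (e), VL, K3 or superconductivity.
References: BGM 2006 §2.7 (2.71), §2.8 (2.76)–(2.90), §3 [cite: BenfattoGiulianiMastropietro2006]; Salmhofer 1998 §4.1.
-/

namespace Summit.HubbardSuperconductivity.HubbardSuperconductivity.Theorems.TwoVolumeLip

set_option linter.dupNamespace false -- summit = problem name (single-conjunct summit), D-0017

open Finset Literature.MathematicalPhysics.QuantumLattice GrassmannAlgebra Literature.Probability.LatticeModels
open Literature.MathematicalPhysics.QuantumLattice.FermiRG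
open Summit.HubbardSuperconductivity.HubbardSuperconductivity.Theorems.KLRegimeSplit
open Summit.HubbardSuperconductivity.HubbardSuperconductivity.Theorems.KLProgrammeLegKernels
open Summit.HubbardSuperconductivity.HubbardSuperconductivity.Theorems.DispersionFlow
open Summit.HubbardSuperconductivity.HubbardSuperconductivity.Theorems.EngineV8
open Summit.HubbardSuperconductivity.HubbardSuperconductivity.Theorems.TwoVolumeSource
open Summit.HubbardSuperconductivity.HubbardSuperconductivity.Theorems.TwoVolumeDefect

noncomputable section

variable {L b M : ℕ} [NeZero L] [NeZero (b * L)] [NeZero M]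

/-- **F-D6 (summand) — a re-measured born difference through the transfer door.**  For blocks `k′ < k` the summand
`map (toLin′ klJump′_{dk−1,dk′}) (klLipBorn (bL) k′) − klGlue (map (toLin′ klJump_{dk−1,dk′}) (klLipBorn L k′))` of `klLipInputDiff_eq_base_add_sum` is bounded at an
output pin by `…LipGlueTransfer.klGlue_transfer_le` with `T′, T := klJump (bL), klJump L` (periodisation DISCHARGED: `klJump_periodise`), `W′, W := klLipBorn (bL), klLipBorn L`,
whose defect is the born difference `klLipBornDiff … d k′` of block `k′` (`klLipBornDiff_def`) — so `E`, `ND` are the deep-pin / global born-difference profiles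
of block `k′` (`…LipSourceTransfer.sum_pinned_norm_kernel_klLipBornDiff_le_of_parts`).  Named: the column / window / pin rows `a` and far tails `τ` of the
fine jump matrix, the coarse born profiles `N`, `N_far` of block `k′`. -/
theorem lipRemeasureSummand_le {β : ℝ} (hβ : β ≠ 0) (U μ : ℝ) (K : TrigPolyC4v) (d k k' : ℕ)
    {n : ℕ} (p : Fin (n + 1)) (w' : SpaceTimeIdx (b * L) M × SectorLeg (sectorCount (d * k - 1)))
    (Z Near : SpaceTimeIdx L M × SectorLeg (sectorCount (d * k')) → Prop) [DecidablePred Z] [DecidablePred Near]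
    (Far : SpaceTimeIdx L M × SectorLeg (sectorCount (d * k')) → SpaceTimeIdx L M × SectorLeg (sectorCount (d * k')) → Prop)
    [DecidableRel Far] (hZ : ∀ y y', Near y → Z y' → Far y y')
    (NearF : SpaceTimeIdx (b * L) M × SectorLeg (sectorCount (d * k')) → Prop) [DecidablePred NearF]
    {a τ N Nfar E ND : ℝ} (ha : 0 ≤ a) (hτ0 : 0 ≤ τ) (hN0 : 0 ≤ N) (hNfar0 : 0 ≤ Nfar) (hE0 : 0 ≤ E) (hND0 : 0 ≤ ND)
    (hcol : ∀ y', ∑ x, ‖klJump (b * L) M β μ K (d * k - 1) (d * k') x y'‖ ≤ a)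
    (hwin : ∀ (B' : Fin 2 → Fin b) (y : SpaceTimeIdx L M × SectorLeg (sectorCount (d * k'))),
      ∑ B : Fin 2 → Fin b, ∑ x ∈ univ.filter (fun x : SpaceTimeIdx (b * L) M × SectorLeg (sectorCount (d * k - 1)) =>
          (klBlockEquiv L b M (sectorCount (d * k - 1)) x).1 = B'),
        ‖klJump (b * L) M β μ K (d * k - 1) (d * k') x ((klBlockEquiv L b M (sectorCount (d * k'))).symm (B, y))‖ ≤ a)
    (hρ : ∑ y, ‖klJump (b * L) M β μ K (d * k - 1) (d * k') w'
        ((klBlockEquiv L b M (sectorCount (d * k'))).symm ((klBlockEquiv L b M (sectorCount (d * k - 1)) w').1, y))‖ ≤ a)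
    (hrowF : ∑ y' ∈ univ.filter (fun y' : SpaceTimeIdx (b * L) M × SectorLeg (sectorCount (d * k')) => NearF y'),
      ‖klJump (b * L) M β μ K (d * k - 1) (d * k') w' y'‖ ≤ a)
    (hτF : ∑ y' ∈ univ.filter (fun y' : SpaceTimeIdx (b * L) M × SectorLeg (sectorCount (d * k')) => ¬ NearF y'),
      ‖klJump (b * L) M β μ K (d * k - 1) (d * k') w' y'‖ ≤ τ)
    (hτ₁ : ∀ y, ¬ Z y → ∑ x ∈ univ.filter (fun x : SpaceTimeIdx (b * L) M × SectorLeg (sectorCount (d * k - 1)) =>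
        (klBlockEquiv L b M (sectorCount (d * k - 1)) x).1 ≠ (klBlockEquiv L b M (sectorCount (d * k - 1)) w').1),
      ‖klJump (b * L) M β μ K (d * k - 1) (d * k') x
        ((klBlockEquiv L b M (sectorCount (d * k'))).symm ((klBlockEquiv L b M (sectorCount (d * k - 1)) w').1, y))‖ ≤ τ)
    (hτ₂ : ∑ B ∈ univ.erase (klBlockEquiv L b M (sectorCount (d * k - 1)) w').1, ∑ y,
      ‖klJump (b * L) M β μ K (d * k - 1) (d * k') w' ((klBlockEquiv L b M (sectorCount (d * k'))).symm (B, y))‖ ≤ τ)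
    (hτ₃ : ∑ y ∈ univ.filter (fun y : SpaceTimeIdx L M × SectorLeg (sectorCount (d * k')) => ¬ Near y),
      ‖klJump (b * L) M β μ K (d * k - 1) (d * k') w'
        ((klBlockEquiv L b M (sectorCount (d * k'))).symm ((klBlockEquiv L b M (sectorCount (d * k - 1)) w').1, y))‖ ≤ τ)
    (hτ₄ : ∀ y, ¬ Z y → ∑ B ∈ univ.erase (klBlockEquiv L b M (sectorCount (d * k - 1)) w').1,
      ∑ x ∈ univ.filter (fun x : SpaceTimeIdx (b * L) M × SectorLeg (sectorCount (d * k - 1)) =>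
          (klBlockEquiv L b M (sectorCount (d * k - 1)) x).1 = (klBlockEquiv L b M (sectorCount (d * k - 1)) w').1),
        ‖klJump (b * L) M β μ K (d * k - 1) (d * k') x ((klBlockEquiv L b M (sectorCount (d * k'))).symm (B, y))‖ ≤ τ)
    (hN : ∀ y, ∑ Y ∈ univ.filter (fun Y : Fin (n + 1) → SpaceTimeIdx L M × SectorLeg (sectorCount (d * k')) => Y p = y),
      ‖kernel ℂ (klLipBorn L M β U μ K d k') (n + 1) Y‖ ≤ N)
    (hNfar : ∀ y (i : Fin (n + 1)),
      ∑ Y ∈ univ.filter (fun Y : Fin (n + 1) → SpaceTimeIdx L M × SectorLeg (sectorCount (d * k')) => Y p = y ∧ Far (Y p) (Y i)),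
        ‖kernel ℂ (klLipBorn L M β U μ K d k') (n + 1) Y‖ ≤ Nfar)
    (hE : ∀ y', NearF y' →
      ∑ Y' ∈ univ.filter (fun Y' : Fin (n + 1) → SpaceTimeIdx (b * L) M × SectorLeg (sectorCount (d * k')) => Y' p = y'),
        ‖kernel ℂ (klLipBornDiff L b M β U μ K d k') (n + 1) Y'‖ ≤ E)
    (hND : ∀ y',
      ∑ Y' ∈ univ.filter (fun Y' : Fin (n + 1) → SpaceTimeIdx (b * L) M × SectorLeg (sectorCount (d * k')) => Y' p = y'),
        ‖kernel ℂ (klLipBornDiff L b M β U μ K d k') (n + 1) Y'‖ ≤ ND) :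
    ∑ X' ∈ univ.filter (fun X' : Fin (n + 1) → SpaceTimeIdx (b * L) M × SectorLeg (sectorCount (d * k - 1)) => X' p = w'),
        ‖kernel ℂ (ExteriorAlgebra.map (Matrix.toLin' (klJump (b * L) M β μ K (d * k - 1) (d * k'))) (klLipBorn (b * L) M β U μ K d k') -
            klGlue L b M (sectorCount (d * k - 1))
              (ExteriorAlgebra.map (Matrix.toLin' (klJump L M β μ K (d * k - 1) (d * k'))) (klLipBorn L M β U μ K d k'))) (n + 1) X'‖ ≤
      a ^ n * (a * E + τ * ND) + (2 * a ^ n * τ * N + n * a ^ n * (5 * τ * N + 2 * a * Nfar)) := by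
  refine klGlue_transfer_le (klJump (b * L) M β μ K (d * k - 1) (d * k')) (klJump L M β μ K (d * k - 1) (d * k'))
    (fun X' Y => klJump_periodise hβ μ K (d * k - 1) (d * k') X' Y) (klLipBorn (b * L) M β U μ K d k') (klLipBorn L M β U μ K d k') p w'
    Z Near Far hZ NearF ha hτ0 hN0 hNfar0 hE0 hND0 hcol hwin hρ hrowF hτF hτ₁ hτ₂ hτ₃ hτ₄ hN hNfar (fun y' hy' => ?_) (fun y' => ?_)
  · rw [← klLipBornDiff_def]; exact hE y' hy'
  · rw [← klLipBornDiff_def]; exact hND y'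

/-- **F-D6 (pin level) — the input difference of block `k` at a pin is at most (base bound) + Σ_{k′<k} (summand bounds)** (`2 ≤ d`):
`klLipInputDiff_eq_base_add_sum`, `kernel_add` / `kernel_sum`, the triangle inequality termwise, and the bounds `B₀` (base: the two-volume difference of
`𝒱₀` analysed at `F_{dk−1}`) and `B k′` (`lipRemeasureSummand_le`). -/
theorem sum_pinned_norm_kernel_klLipInputDiff_le_of_parts {β : ℝ} (hβ : β ≠ 0) (U μ : ℝ) (K : TrigPolyC4v) {d : ℕ} (hd : 2 ≤ d) (k : ℕ)
    {m : ℕ} (i : Fin m) (w : SpaceTimeIdx (b * L) M × SectorLeg (sectorCount (d * k - 1))) {B₀ : ℝ} {B : ℕ → ℝ}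
    (h₀ : ∑ X ∈ univ.filter (fun X : Fin m → SpaceTimeIdx (b * L) M × SectorLeg (sectorCount (d * k - 1)) => X i = w),
      ‖kernel ℂ (sectorPreimage β (klAnisoFamily (b * L) M β μ K klE0 (d * k - 1)) (klEffectiveAction (b * L) M β U μ K klE0 0) -
          klGlue L b M (sectorCount (d * k - 1))
            (sectorPreimage β (klAnisoFamily L M β μ K klE0 (d * k - 1)) (klEffectiveAction L M β U μ K klE0 0))) m X‖ ≤ B₀)
    (h : ∀ k' ∈ range k, ∑ X ∈ univ.filter (fun X : Fin m → SpaceTimeIdx (b * L) M × SectorLeg (sectorCount (d * k - 1)) => X i = w),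
      ‖kernel ℂ (ExteriorAlgebra.map (Matrix.toLin' (klJump (b * L) M β μ K (d * k - 1) (d * k'))) (klLipBorn (b * L) M β U μ K d k') -
          klGlue L b M (sectorCount (d * k - 1))
            (ExteriorAlgebra.map (Matrix.toLin' (klJump L M β μ K (d * k - 1) (d * k'))) (klLipBorn L M β U μ K d k'))) m X‖ ≤ B k') :
    ∑ X ∈ univ.filter (fun X : Fin m → SpaceTimeIdx (b * L) M × SectorLeg (sectorCount (d * k - 1)) => X i = w),
        ‖kernel ℂ (klLipInputDiff L b M β U μ K d k) m X‖ ≤ B₀ + ∑ k' ∈ range k, B k' := by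
  rw [klLipInputDiff_eq_base_add_sum hβ U μ K hd k]
  calc _ ≤ ∑ X ∈ univ.filter (fun X : Fin m → SpaceTimeIdx (b * L) M × SectorLeg (sectorCount (d * k - 1)) => X i = w),
        (‖kernel ℂ (sectorPreimage β (klAnisoFamily (b * L) M β μ K klE0 (d * k - 1)) (klEffectiveAction (b * L) M β U μ K klE0 0) -
            klGlue L b M (sectorCount (d * k - 1))
              (sectorPreimage β (klAnisoFamily L M β μ K klE0 (d * k - 1)) (klEffectiveAction L M β U μ K klE0 0))) m X‖ +
          ∑ k' ∈ range k,
            ‖kernel ℂ (ExteriorAlgebra.map (Matrix.toLin' (klJump (b * L) M β μ K (d * k - 1) (d * k'))) (klLipBorn (b * L) M β U μ K d k') -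
                klGlue L b M (sectorCount (d * k - 1))
                  (ExteriorAlgebra.map (Matrix.toLin' (klJump L M β μ K (d * k - 1) (d * k'))) (klLipBorn L M β U μ K d k'))) m X‖) := by
        refine Finset.sum_le_sum fun X _ => ?_
        rw [kernel_add, kernel_sum]
        exact (norm_add_le _ _).trans (by gcongr; exact norm_sum_le _ _)
    _ ≤ B₀ + ∑ k' ∈ range k, B k' := by
        rw [Finset.sum_add_distrib, Finset.sum_comm]
        exact add_le_add h₀ (Finset.sum_le_sum h)

end

end Summit.HubbardSuperconductivity.HubbardSuperconductivity.Theorems.TwoVolumeLip
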